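import Summits.AtomisticToContinuum.FouriersLaw.Theorems.BondHeatUncertaintySubdiffusiveBondHeatJunctionRatioBootstrap
import Summits.AtomisticToContinuum.FouriersLaw.Theorems.BondHeatUncertaintySubdiffusiveBondHeatJunctionRatioLocality
import Summits.AtomisticToContinuum.FouriersLaw.Theorems.BondHeatUncertaintySubdiffusiveBondHeatJunctionRatioDini

/-!
# Relative locality door — BY-NAME frames over `…JunctionRatioLadder`/`…RatioBootstrap` (13a/13b) and `…RatioLocality`/`…RatioDini` (15a/15b)

Support file for stmt-AtomisticToContinuum-11071, decomposition cell `decomp-a2c`, lens-1, gen 59 — file (16) (imports re-pointed at gen 60 to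
the split parts, critic row 802; body unchanged).  Land AFTER (13a), (13b), (15a), (15b) are BUILT.  No definitions, no new mathematics: each
theorem is a file-(15) theorem whose unfolded conclusion is re-read as the file-(13) Prop it literally is (`SeriesRatioLaw ρ'`,
`AsymptoticSeriesLaw`), plus the composed nodes `(∀ ρ < 1, RelativeLocalityLaw ρ) ∧ EscapeInfZero ∧ SubOhmicBootstrap ⟹ 11071` and
`DiniSeriesLaw ⟹ AsymptoticSeriesLaw`, and the exponent rung delivered by one relative-locality rung.  No `sorry`; standard axioms; nothing
here closes an item.
-/

noncomputable section

namespace Summit.AtomisticToContinuum.FouriersLaw.Theorems.SubdiffusiveBondHeat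

namespace EscapeGrading

open Summit.AtomisticToContinuum.FouriersLaw.Theses.BondHeatUncertainty (BoundedResponse NonBallistic)

/-- **Per rung, by name: `RelativeLocalityLaw ρ ∧ EscapeInfZero ⟹ SeriesRatioLaw ρ'`** for every `ρ' < ρ`. [frame] -/
theorem seriesRatioLaw_of_relativeLocalityLaw_of_escapeInfZero {ρ ρ' : ℝ} (hρ' : ρ' < ρ) (hL : RelativeLocalityLaw ρ)
    (hI : EscapeInfZero) : SeriesRatioLaw ρ' :=
  seriesRatio_of_relativeLocalityLaw_of_escapeInfZero hρ' hL hI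

/-- **THE DOOR, by name: `(∀ ρ < 1, RelativeLocalityLaw ρ) ∧ EscapeInfZero ⟹ AsymptoticSeriesLaw`.** [frame] -/
theorem asymptoticSeriesLaw_of_relativeLocality_of_escapeInfZero (hL : ∀ ρ : ℝ, ρ < 1 → RelativeLocalityLaw ρ)
    (hI : EscapeInfZero) : AsymptoticSeriesLaw :=
  asymptoticSeries_of_relativeLocality_of_escapeInfZero hL hI

/-- The door with the partner named as the route item `NonBallistic` (stmt-9127). [frame] -/
theorem asymptoticSeriesLaw_of_relativeLocality_of_nonBallistic (hL : ∀ ρ : ℝ, ρ < 1 → RelativeLocalityLaw ρ)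
    (hN : NonBallistic) : AsymptoticSeriesLaw :=
  asymptoticSeries_of_relativeLocality_of_nonBallistic hL hN

/-- **One relative rung delivers a transport exponent: `RelativeLocalityLaw ρ ∧ EscapeInfZero ⟹ ExponentFloor s` whenever `2^s < 2ρ`**
(`0 ≤ s`; take `ρ' = 2^s/2 < ρ` and file (13)'s dictionary). [frame] -/
theorem exponentFloor_of_relativeLocalityLaw_of_escapeInfZero {ρ s : ℝ} (hs : 0 ≤ s) (hρs : (2 : ℝ) ^ s < 2 * ρ)
    (hL : RelativeLocalityLaw ρ) (hI : EscapeInfZero) : ExponentFloor s :=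
  exponentFloor_of_seriesRatioLaw (ρ := (2 : ℝ) ^ s / 2) hs (by linarith)
    (seriesRatioLaw_of_relativeLocalityLaw_of_escapeInfZero (by linarith) hL hI)

/-- **The three-piece node, by name: `(∀ ρ < 1, RelativeLocalityLaw ρ) ∧ EscapeInfZero ∧ SubOhmicBootstrap ⟹ BoundedResponse` (11071).**
[frame] -/
theorem boundedResponse_of_relativeLocality_of_escapeInfZero_of_subOhmicBootstrap
    (hL : ∀ ρ : ℝ, ρ < 1 → RelativeLocalityLaw ρ) (hI : EscapeInfZero) (hB : SubOhmicBootstrap) : BoundedResponse :=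
  boundedResponse_of_asymptoticSeriesLaw_of_subOhmicBootstrap (asymptoticSeriesLaw_of_relativeLocality_of_escapeInfZero hL hI) hB

/-- The mechanism node, by name: `(∀ ρ < 1, RelativeLocalityLaw ρ) ∧ EscapeInfZero ∧ BufferedJunctionLaw ⟹ BoundedResponse`. [frame] -/
theorem boundedResponse_of_relativeLocality_of_escapeInfZero_of_bufferedJunctionLaw
    (hL : ∀ ρ : ℝ, ρ < 1 → RelativeLocalityLaw ρ) (hI : EscapeInfZero) (hJ : JunctionDefectGrading.BufferedJunctionLaw) :
    BoundedResponse :=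
  boundedResponse_of_asymptoticSeriesLaw_of_bufferedJunctionLaw (asymptoticSeriesLaw_of_relativeLocality_of_escapeInfZero hL hI) hJ

/-- **`DiniSeriesLaw ⟹ AsymptoticSeriesLaw`, by name** (the threshold rung lies above the necessary side of the relative axis). [frame] -/
theorem asymptoticSeriesLaw_of_diniSeriesLaw (hD : DiniSeriesLaw) : AsymptoticSeriesLaw :=
  seriesRatio_of_diniSeriesLaw hD

/-- `SeriesRatioLaw ρ ∧ BufferedJunctionLaw ⟹ DiniSeriesLaw` for every `ρ > 1/2` (through `ExponentFloor s`, `2^s = 2ρ`, `s > 0`): the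
g58 mechanism node FACTORS through the Dini threshold. [frame] -/
theorem diniSeriesLaw_of_seriesRatioLaw_of_bufferedJunctionLaw {ρ : ℝ} (hρ : 1 / 2 < ρ) (hR : SeriesRatioLaw ρ)
    (hJ : JunctionDefectGrading.BufferedJunctionLaw) : DiniSeriesLaw := by
  obtain ⟨s, hs, -, hF⟩ := exponentFloor_pos_of_seriesRatioLaw hρ hR
  exact diniSeriesLaw_of_bufferedJunctionLaw_of_exponentFloor hs hJ hF

end EscapeGrading

end Summit.AtomisticToContinuum.FouriersLaw.Theorems.SubdiffusiveBondHeat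

end
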